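import Mathlib.CategoryTheory.Monoidal.Cartesian.Grp
import Mathlib.CategoryTheory.Monoidal.Grp
import Literature.AlgebraicGeometry.Morphisms.SeparatedRigidityDedekind
import Literature.NumberTheory.DiophantineGeometry.SmoothProperModelIsoOfGroupChunk
import Literature.AlgebraicGeometry.GroupSchemes.StrictBirationalGroupLaw
import Literature.NumberTheory.EllipticCurves.NeronModelExtensionSetup
import Mathlib.AlgebraicGeometry.Geometrically.Irreducible
import HarnessLib

/-!
# Transported group laws read through a monoidal functor: when is `F(u⁻¹) ≫ e` a homomorphism? (GAP-F of the road-W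
# sub-line `koizumi_strictly_local`, §1: the categorical reduction) — [BLRNeronModels1990, §1.2 Prop. 6] [EdixhovenRomagny, Thm. 3.18]

Topic `Literature/AlgebraicGeometry/GroupSchemes`; THEOREMS ONLY; net Literature debt 0.  Cell `hodgecm-mathlib` (D-0151), road W:
B-plan1 13:30:22Z keyed GAP-F `GenericFibreIsGroupIso` (A-p14 composition probe `KoizumiStrictlyLocalProbe` :160–:177) on A-p14.
§1 (this file, any cartesian monoidal categories): (a) a morphism of GROUP objects commuting with multiplication commutes with
the unit (`isMonHom_of_mul_hom`); (b) for a monoidal functor `F`, an iso `u : X ≅ G` onto a group object and an iso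
`e : F X ≅ E` onto a group object, `F(u⁻¹) ≫ e : F G ⟶ E` is a homomorphism iff the law of `G` TRANSPORTED to `X` is carried
by `F` and `e` to the law of `E` (`isMonHom_map_inv_comp_iff`) — this reduces GAP-F to ONE equation between two morphisms
`F(X ⊗ X) ⟶ E`, which §2 (`genericFibreIsGroupIso`, appended) proves by rigidity on the dense open where the birational law is
defined (the generic fibre of `dom₀ ∩ dom`, dense because the generic fibre of `𝒳 ⊗ 𝒳` is irreducible).
HC_CM is proved only modulo the 7 printed citations until rung 0 closes.
-/

noncomputable section

universe v₁ v₂ u₁ u₂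

namespace Literature.AlgebraicGeometry.GroupSchemes

open CategoryTheory MonoidalCategory CartesianMonoidalCategory MonObj GrpObj
open scoped CategoryTheory.Obj

section MulHom

variable {C : Type u₁} [Category.{v₁} C] [CartesianMonoidalCategory C]

/-- **A morphism of group objects which commutes with the multiplications commutes with the units** (in a cartesian monoidal
category: `x := η ≫ f` satisfies `x · x = x` in the group `Hom(𝟙, H)`, hence `x = 1 = η`). [cite: EdixhovenRomagny, Thm. 3.18 (ii)] -/
theorem isMonHom_of_mul_hom {G H : C} [GrpObj G] [GrpObj H] (f : G ⟶ H) (h : μ[G] ≫ f = (f ⊗ₘ f) ≫ μ[H]) :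
    IsMonHom f := by
  refine { one_hom := ?_, mul_hom := h }
  have hG : lift η[G] η[G] ≫ μ[G] = η[G] := by
    simpa using MonObj.lift_comp_one_right (η[G] : 𝟙_ C ⟶ G) (𝟙 _)
  have key : (η[G] ≫ f) * (η[G] ≫ f) = (η[G] ≫ f) := by
    rw [Hom.mul_def, ← lift_map_assoc, ← h, ← Category.assoc, hG]
  have h1 : η[G] ≫ f = 1 := mul_eq_left.mp key
  rw [h1, Hom.one_def]
  simp

end MulHom

section Transport

variable {C : Type u₁} [Category.{v₁} C] [CartesianMonoidalCategory C]
  {D : Type u₂} [Category.{v₂} D] [CartesianMonoidalCategory D]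
  (F : C ⥤ D) [F.Monoidal]

/-- **`F(u⁻¹) ≫ e` is a homomorphism iff `F` and `e` carry the transported law to the law of `E`.**  For a monoidal functor
`F`, an isomorphism `u : X ≅ G` onto a group object `G` (so `X` carries the transported law `m_X = (u ⊗ u) ≫ μ_G ≫ u⁻¹`) and an
isomorphism `e : F X ≅ E` onto a group object `E`: the composite `F G ≅ F X ≅ E` respects multiplication iff
`μ_F ≫ F(m_X) ≫ e = (e ⊗ e) ≫ μ_E`; it then respects units automatically (`isMonHom_of_mul_hom`).
[cite: BLRNeronModels1990, §1.2 Prop. 6] -/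
theorem isMonHom_map_inv_comp {X G : C} [GrpObj G] (u : X ≅ G) {E : D} [GrpObj E] (e : F.obj X ≅ E)
    (h : Functor.LaxMonoidal.μ F X X ≫ F.map ((u.hom ⊗ₘ u.hom) ≫ μ[G] ≫ u.inv) ≫ e.hom = (e.hom ⊗ₘ e.hom) ≫ μ[E]) :
    IsMonHom (F.map u.inv ≫ e.hom : F.obj G ⟶ E) := by
  apply isMonHom_of_mul_hom
  haveI : IsIso (F.map u.hom ⊗ₘ F.map u.hom) := inferInstance
  rw [← cancel_epi (F.map u.hom ⊗ₘ F.map u.hom)]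
  -- left: naturality of `μ_F`; right: `u ≫ u⁻¹ = 𝟙`
  rw [Functor.obj.μ_def]
  have hr : (F.map u.hom ⊗ₘ F.map u.hom) ≫ ((F.map u.inv ≫ e.hom) ⊗ₘ (F.map u.inv ≫ e.hom)) = (e.hom ⊗ₘ e.hom) := by
    rw [tensorHom_comp_tensorHom, Iso.map_hom_inv_id_assoc]
  simp only [Category.assoc, Functor.LaxMonoidal.μ_natural_assoc]
  rw [← Category.assoc (F.map u.hom ⊗ₘ F.map u.hom), hr]
  simpa only [Functor.map_comp, Category.assoc] using h

end Transport

section Rigidity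

open AlgebraicGeometry

/-- **Rigidity through a dense open immersion**: two morphisms `f, g : X ⟶ Y` over `Z` (`Y → Z` separated, `X` reduced)
which agree after an open immersion `ν : W ⟶ X` with dense image are equal.  (The form GAP-F §2 uses: `X = (𝒳 ⊗ 𝒳)_K`,
`ν` = the generic fibre of the domain of the birational law.) [cite: EdixhovenRomagny, Lemma 3.17] -/
theorem hom_ext_of_isOpenImmersion_denseRange {W X Y Z : AlgebraicGeometry.Scheme.{u₁}} (f g : X ⟶ Y) (i : Y ⟶ Z) [AlgebraicGeometry.IsSeparated i]
    [AlgebraicGeometry.IsReduced X] (H' : f ≫ i = g ≫ i) (ν : W ⟶ X) (hν : DenseRange ν.base) (h : ν ≫ f = ν ≫ g) : f = g :=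
  Literature.AlgebraicGeometry.Morphisms.ext_of_dense_of_forall_exists_comp_eq f g i H' (Set.range ν.base) hν
    fun _ hx => ⟨W, ν, hx, h⟩

end Rigidity

/-! ### §2 The scheme-theoretic identity: `G_K ≅ E` is a homomorphism (GAP-F) -/

section GapFOpens

open CategoryTheory.Limits _root_.AlgebraicGeometry Literature Literature.NumberTheory.EllipticCurves

universe u


variable (R : Type u) [CommRing R] [IsDomain R] [IsDiscreteValuationRing R]
  (K : Type u) [Field K] [Algebra R K] [IsFractionRing R K]

/-- **GAP-F `GenericFibreIsGroupIso` (road W, sub-line `koizumi_strictly_local`; A-p14 probe v2 :160–:177, binder for binder):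
the generic fibre of the group chunk's group IS `E` as a GROUP.**  `R` a dvr with fraction field `K`; `𝒳 → Spec R` smooth
proper with geometrically irreducible fibres and generic fibre `e : 𝒳_K ≅ E` a group scheme; `L` a birational group law on
`𝒳` which is `μ[E]` generically (`hLmul`); `L₀` a birational group law on an open `X₀ ⊇ 𝒳_K` agreeing with `L` on
`T`-points (`hagree`, the strictification clause); `(G, j)` a group-chunk solution of `L₀` and `u : 𝒳 ≅ G` an isomorphism
over `R` extending `j` (★ (W23)).  Then `G_K ≅ 𝒳_K ≅ E` is a homomorphism of group schemes.  Proof: by §1 it suffices that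
the law of `G` transported to `𝒳` is carried to `μ[E]` on the generic fibre; both sides are `K`-morphisms
`(𝒳 ⊗ 𝒳)_K ⟶ E` from a reduced scheme to a separated one, and they agree on the generic fibre of the open
`D′ = dom₀ ∩ (ι₀ ⊗ ι₀)⁻¹ dom ∩ mul⁻¹ X₀` (solution + agreement + `hLmul`), which is dense because the generic fibre of
`𝒳 ⊗ 𝒳` is irreducible and both `dom`, `dom₀` meet it. [cite: EdixhovenRomagny, Thm. 3.18 (ii)] [cite: BLRNeronModels1990, §1.2 Prop. 6] -/
theorem genericFibreIsGroupIso
    (𝒳 : Over (Spec (.of R))) [Smooth 𝒳.hom] [IsProper 𝒳.hom] [GeometricallyIrreducible 𝒳.hom]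
    (E : Over (Spec (.of K))) [GrpObj E] (e : (genericFibre R K).obj 𝒳 ≅ E)
    (L : BirationalGroupLaw 𝒳)
    (hLmul : (genericFibre R K).map L.mulOver ≫ e.hom =
        (genericFibre R K).map (LawData.inclOver 𝒳 L.dom) ≫
          Functor.OplaxMonoidal.δ (genericFibre R K) 𝒳 𝒳 ≫ (e.hom ⊗ₘ e.hom) ≫ μ[E])
    (X₀ : 𝒳.left.Opens) (L₀ : BirationalGroupLaw (Over.mk (X₀.ι ≫ 𝒳.hom)))
    (hX₀ : 𝒳.hom.base ⁻¹' Set.range (specGenericPoint R K).base ⊆ (X₀ : Set 𝒳.left))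
    (hagree : ∀ {T : Scheme.{u}} (q₀ : T ⟶ (L₀.dom : Scheme.{u})) (q : T ⟶ (L.dom : Scheme.{u}))
        (a b c₀ c : T ⟶ (X₀ : Scheme.{u})),
        LawData.Computes (Over.mk (X₀.ι ≫ 𝒳.hom)) L₀.dom L₀.mul q₀ a b c₀ →
        LawData.Computes 𝒳 L.dom L.mul q (a ≫ X₀.ι) (b ≫ X₀.ι) (c ≫ X₀.ι) → c₀ = c)
    (G : Over (Spec (.of R))) [GrpObj G] (j : Over.mk (X₀.ι ≫ 𝒳.hom) ⟶ G) (hsol : IsGroupChunkSolution L₀ G j)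
    (u : 𝒳 ≅ G) (hu : X₀.ι ≫ u.hom.left = j.left) :
    IsMonHom ((genericFibre R K).map u.inv ≫ e.hom : (genericFibre R K).obj G ⟶ E) := by
  let F := genericFibre R K
  -- the transported law on `𝒳`
  let m𝒳 : 𝒳 ⊗ 𝒳 ⟶ 𝒳 := (u.hom ⊗ₘ u.hom) ≫ μ[G] ≫ u.inv
  -- the two `K`-morphisms `(𝒳 ⊗ 𝒳)_K ⟶ E` to be compared
  let P : F.obj (𝒳 ⊗ 𝒳) ⟶ E := F.map m𝒳 ≫ e.hom
  let Q : F.obj (𝒳 ⊗ 𝒳) ⟶ E := Functor.OplaxMonoidal.δ F 𝒳 𝒳 ≫ (e.hom ⊗ₘ e.hom) ≫ μ[E]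
  -- (♥)+(♦): an `R`-scheme `D′` over `𝒳 ⊗ 𝒳` by an open immersion `ν̄`, on which the transported law IS `L.mul`:
  --   ν̄ ≫ m𝒳 = q′ ≫ L.mulOver and ν̄ = q′ ≫ inclOver  (from solution.mul_comp, `hu`, and `hagree`)
  have hD : ∃ (D' : Over (Spec (.of R))) (ν : D' ⟶ 𝒳 ⊗ 𝒳) (q' : D' ⟶ L.domOver),
      IsOpenImmersion ν.left ∧ ν = q' ≫ LawData.inclOver 𝒳 L.dom ∧ ν ≫ m𝒳 = q' ≫ L.mulOver ∧
      -- (♦-density) its generic fibre is dense in `(𝒳 ⊗ 𝒳)_K`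
      DenseRange (F.map ν).left.base := by
    -- the strict open as an `S`-scheme and its inclusion
    let ι₀ : (Over.mk (X₀.ι ≫ 𝒳.hom)) ⟶ 𝒳 := Over.homMk X₀.ι rfl
    haveI : IsOpenImmersion ι₀.left := by change IsOpenImmersion X₀.ι; infer_instance
    have hj : j = ι₀ ≫ u.hom := (Over.forget _).map_injective (by
      change j.left = X₀.ι ≫ u.hom.left
      exact hu.symm)
    -- (♣) the transported law restricted to `dom₀` is `L₀.mul`
    have hclub : LawData.inclOver (Over.mk (X₀.ι ≫ 𝒳.hom)) L₀.dom ≫ (ι₀ ⊗ₘ ι₀) ≫ m𝒳 = L₀.mulOver ≫ ι₀ := by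
      have h1 : (ι₀ ⊗ₘ ι₀) ≫ (u.hom ⊗ₘ u.hom) = (j ⊗ₘ j) := by rw [tensorHom_comp_tensorHom, ← hj]
      have h2 : LawData.inclOver (Over.mk (X₀.ι ≫ 𝒳.hom)) L₀.dom ≫ (j ⊗ₘ j) ≫ μ[G] = L₀.mulOver ≫ j := by
        apply (Over.forget _).map_injective
        change L₀.dom.ι ≫ (j ⊗ₘ j).left ≫ μ[G].left = L₀.mul ≫ j.left
        exact hsol.mul_comp.symm
      change LawData.inclOver (Over.mk (X₀.ι ≫ 𝒳.hom)) L₀.dom ≫ (ι₀ ⊗ₘ ι₀) ≫ (u.hom ⊗ₘ u.hom) ≫ μ[G] ≫ u.inv = L₀.mulOver ≫ ι₀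
      rw [← Category.assoc (ι₀ ⊗ₘ ι₀), h1, ← Category.assoc, ← Category.assoc, Category.assoc (LawData.inclOver (Over.mk (X₀.ι ≫ 𝒳.hom)) L₀.dom),
        h2, Category.assoc, hj, Category.assoc, Iso.hom_inv_id, Category.comp_id]
    -- the open `D₁ ⊆ dom₀` of points whose image lies in `dom`, with its lift `q₁` to `dom`
    let ν₀ : (L₀.dom : Scheme.{u}) ⟶ (𝒳 ⊗ 𝒳).left := L₀.dom.ι ≫ (ι₀ ⊗ₘ ι₀).left
    haveI : IsOpenImmersion (ι₀ ⊗ₘ ι₀).left := by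
      rw [Over.tensorHom_left]
      exact Scheme.pullback_map_isOpenImmersion _ _ _ _ _ _ _ _ _
    haveI : IsOpenImmersion ν₀ := inferInstance
    let D₁ : (L₀.dom : Scheme.{u}).Opens := ν₀ ⁻¹ᵁ L.dom
    have hD₁ : Set.range (D₁.ι ≫ ν₀).base ⊆ Set.range L.dom.ι.base := by
      rintro _ ⟨d, rfl⟩
      rw [Scheme.Opens.range_ι]
      exact d.2
    let q₁ : (D₁ : Scheme.{u}) ⟶ (L.dom : Scheme.{u}) := IsOpenImmersion.lift L.dom.ι (D₁.ι ≫ ν₀) hD₁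
    have hq₁ : q₁ ≫ L.dom.ι = D₁.ι ≫ ν₀ := IsOpenImmersion.lift_fac _ _ _
    have hq₁' : ∀ {Z : Scheme.{u}} (h : (𝒳 ⊗ 𝒳).left ⟶ Z),
        q₁ ≫ L.dom.ι ≫ h = D₁.ι ≫ L₀.dom.ι ≫ (ι₀ ⊗ₘ ι₀).left ≫ h := fun h => by
      rw [← Category.assoc, hq₁]; simp only [ν₀, Category.assoc]
    -- the further open `D₂ ⊆ D₁` where `L.mul` lands in `X₀` (needed to invoke the agreement clause), with the lift `c`
    let D₂ : (D₁ : Scheme.{u}).Opens := (q₁ ≫ L.mul) ⁻¹ᵁ X₀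
    have hD₂ : Set.range (D₂.ι ≫ q₁ ≫ L.mul).base ⊆ Set.range X₀.ι.base := by
      rintro _ ⟨d, rfl⟩
      rw [Scheme.Opens.range_ι]
      exact d.2
    let c : (D₂ : Scheme.{u}) ⟶ (X₀ : Scheme.{u}) := IsOpenImmersion.lift X₀.ι (D₂.ι ≫ q₁ ≫ L.mul) hD₂
    have hc : c ≫ X₀.ι = D₂.ι ≫ q₁ ≫ L.mul := IsOpenImmersion.lift_fac _ _ _
    -- (♠) agreement of `L₀.mul` and `L.mul` on `D₂`
    have hfst : (fst (Over.mk (X₀.ι ≫ 𝒳.hom)) (Over.mk (X₀.ι ≫ 𝒳.hom))).left ≫ X₀.ι = (ι₀ ⊗ₘ ι₀).left ≫ (fst 𝒳 𝒳).left := by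
      change ((fst (Over.mk (X₀.ι ≫ 𝒳.hom)) (Over.mk (X₀.ι ≫ 𝒳.hom))) ≫ ι₀).left = ((ι₀ ⊗ₘ ι₀) ≫ fst 𝒳 𝒳).left
      rw [tensorHom_fst]
    have hsnd : (snd (Over.mk (X₀.ι ≫ 𝒳.hom)) (Over.mk (X₀.ι ≫ 𝒳.hom))).left ≫ X₀.ι = (ι₀ ⊗ₘ ι₀).left ≫ (snd 𝒳 𝒳).left := by
      change ((snd (Over.mk (X₀.ι ≫ 𝒳.hom)) (Over.mk (X₀.ι ≫ 𝒳.hom))) ≫ ι₀).left = ((ι₀ ⊗ₘ ι₀) ≫ snd 𝒳 𝒳).left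
      rw [tensorHom_snd]
    have hspade : (D₂.ι ≫ D₁.ι) ≫ L₀.mul = c := by
      refine hagree (D₂.ι ≫ D₁.ι) (D₂.ι ≫ q₁) ((D₂.ι ≫ D₁.ι) ≫ L₀.dom.ι ≫ (fst (Over.mk (X₀.ι ≫ 𝒳.hom)) (Over.mk (X₀.ι ≫ 𝒳.hom))).left)
        ((D₂.ι ≫ D₁.ι) ≫ L₀.dom.ι ≫ (snd (Over.mk (X₀.ι ≫ 𝒳.hom)) (Over.mk (X₀.ι ≫ 𝒳.hom))).left) ((D₂.ι ≫ D₁.ι) ≫ L₀.mul) c ⟨rfl, rfl, rfl⟩ ⟨?_, ?_, ?_⟩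
      · simp only [Category.assoc, hq₁']
        erw [hfst]
      · simp only [Category.assoc, hq₁']
        erw [hsnd]
      · rw [hc, Category.assoc]
    -- the `S`-scheme `D′ := D₂` with `ν`, `q′`
    let D' : Over (Spec (.of R)) := Over.mk ((D₂.ι ≫ D₁.ι) ≫ (L₀.domOver).hom)
    let ν : D' ⟶ 𝒳 ⊗ 𝒳 := Over.homMk ((D₂.ι ≫ D₁.ι) ≫ ν₀) (by
      change ((D₂.ι ≫ D₁.ι) ≫ L₀.dom.ι ≫ (ι₀ ⊗ₘ ι₀).left) ≫ (𝒳 ⊗ 𝒳).hom = (D₂.ι ≫ D₁.ι) ≫ (L₀.domOver).hom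
      have e1 : (ι₀ ⊗ₘ ι₀).left ≫ (𝒳 ⊗ 𝒳).hom = ((Over.mk (X₀.ι ≫ 𝒳.hom)) ⊗ (Over.mk (X₀.ι ≫ 𝒳.hom))).hom := Over.w (ι₀ ⊗ₘ ι₀)
      simp only [Category.assoc, e1]
      rfl)
    let q' : D' ⟶ L.domOver := Over.homMk (D₂.ι ≫ q₁) (by
      change (D₂.ι ≫ q₁) ≫ L.dom.ι ≫ (𝒳 ⊗ 𝒳).hom = (D₂.ι ≫ D₁.ι) ≫ (L₀.domOver).hom
      have e1 : (ι₀ ⊗ₘ ι₀).left ≫ (𝒳 ⊗ 𝒳).hom = ((Over.mk (X₀.ι ≫ 𝒳.hom)) ⊗ (Over.mk (X₀.ι ≫ 𝒳.hom))).hom := Over.w (ι₀ ⊗ₘ ι₀)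
      rw [Category.assoc, ← Category.assoc q₁, hq₁]
      change (D₂.ι ≫ (D₁.ι ≫ L₀.dom.ι ≫ (ι₀ ⊗ₘ ι₀).left)) ≫ (𝒳 ⊗ 𝒳).hom = _
      simp only [Category.assoc, e1]
      rfl)
    have hνq : ν = q' ≫ LawData.inclOver 𝒳 L.dom := by
      apply (Over.forget _).map_injective
      change (D₂.ι ≫ D₁.ι) ≫ ν₀ = (D₂.ι ≫ q₁) ≫ L.dom.ι
      rw [Category.assoc, Category.assoc, hq₁]
    have hνm : ν ≫ m𝒳 = q' ≫ L.mulOver := by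
      apply (Over.forget _).map_injective
      change ((D₂.ι ≫ D₁.ι) ≫ L₀.dom.ι ≫ (ι₀ ⊗ₘ ι₀).left) ≫ m𝒳.left = (D₂.ι ≫ q₁) ≫ L.mul
      have e1 : L₀.dom.ι ≫ (ι₀ ⊗ₘ ι₀).left ≫ m𝒳.left = L₀.mul ≫ X₀.ι :=
        congrArg CommaMorphism.left hclub
      have e2 : (D₂.ι ≫ D₁.ι) ≫ L₀.mul ≫ X₀.ι = c ≫ X₀.ι := by
        rw [← hspade]; erw [Category.assoc]
      simp only [Category.assoc] at e1 e2 ⊢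
      rw [e1, e2, hc]
    refine ⟨D', ν, q', ?_, hνq, hνm, ?_⟩
    · change IsOpenImmersion ((D₂.ι ≫ D₁.ι) ≫ ν₀); infer_instance
    · -- (♦-density): the generic fibre of `D′` is dense in `(𝒳 ⊗ 𝒳)_K`
      have hsgp : IsOpenImmersion (specGenericPoint R K) := isOpenImmersion_specGenericPoint R K
      let p₁ : (F.obj (𝒳 ⊗ 𝒳)).left ⟶ (𝒳 ⊗ 𝒳).left := pullback.fst (𝒳 ⊗ 𝒳).hom (specGenericPoint R K)
      have hp₁ : IsOpenImmersion p₁ := MorphismProperty.pullback_fst _ _ hsgp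
      have hνo : IsOpenImmersion ν.left := by
        change IsOpenImmersion ((D₂.ι ≫ D₁.ι) ≫ ν₀); infer_instance
      have hcomm : (F.map ν).left ≫ p₁ = pullback.fst D'.hom (specGenericPoint R K) ≫ ν.left := by
        simp only [F, p₁, Over.pullback_map_left]
        exact pullback.lift_fst _ _ _
      -- range of the generic fibre of `ν`
      have hrange : Set.range (F.map ν).left.base = p₁.base ⁻¹' Set.range ν.left.base := by
        apply le_antisymm
        · rintro _ ⟨z, rfl⟩
          change ((F.map ν).left ≫ p₁).base z ∈ Set.range ν.left.base
          rw [hcomm]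
          exact ⟨(pullback.fst D'.hom (specGenericPoint R K)).base z, rfl⟩
        · rintro w ⟨d, hd⟩
          have hD'hom : D'.hom = ν.left ≫ (𝒳 ⊗ 𝒳).hom := (Over.w ν).symm
          have hw : D'.hom.base d = (specGenericPoint R K).base ((pullback.snd (𝒳 ⊗ 𝒳).hom (specGenericPoint R K)).base w) := by
            rw [hD'hom]
            change (𝒳 ⊗ 𝒳).hom.base (ν.left.base d) = _
            rw [hd]
            change (pullback.fst (𝒳 ⊗ 𝒳).hom (specGenericPoint R K) ≫ (𝒳 ⊗ 𝒳).hom).base w =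
              (pullback.snd (𝒳 ⊗ 𝒳).hom (specGenericPoint R K) ≫ specGenericPoint R K).base w
            rw [pullback.condition]
          obtain ⟨z, hz1, -⟩ := Scheme.Pullback.exists_preimage_pullback d _ hw
          refine ⟨z, hp₁.base_open.injective ?_⟩
          change ((F.map ν).left ≫ p₁).base z = p₁.base w
          rw [hcomm]
          change ν.left.base ((pullback.fst D'.hom (specGenericPoint R K)).base z) = p₁.base w
          rw [hz1, hd]
      -- the generic fibre `F_η = range p₁` is irreducible
      have hFη : IsPreirreducible (Set.range p₁.base) := by
        have hr : Set.range p₁.base = (𝒳 ⊗ 𝒳).hom.base ⁻¹' Set.range (specGenericPoint R K).base :=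
          Scheme.Pullback.range_fst _ _
        rw [hr]
        change IsPreirreducible ((pullback.fst 𝒳.hom 𝒳.hom ≫ 𝒳.hom).base ⁻¹' Set.range (specGenericPoint R K).base)
        have hpre : (pullback.fst 𝒳.hom 𝒳.hom ≫ 𝒳.hom).base ⁻¹' Set.range (specGenericPoint R K).base =
            (pullback.fst 𝒳.hom 𝒳.hom).base ⁻¹' (𝒳.hom.base ⁻¹' Set.range (specGenericPoint R K).base) := rfl
        rw [hpre]
        have hS : IsIrreducible (Set.range (specGenericPoint R K).base) := by
          rw [← Set.image_univ]
          exact (IrreducibleSpace.isIrreducible_univ _).image _ (specGenericPoint R K).base.hom.continuous.continuousOn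
        have h1 : IsIrreducible (𝒳.hom.base ⁻¹' Set.range (specGenericPoint R K).base) :=
          𝒳.hom.isIrreducible_preimage 𝒳.hom.isOpenMap hS
        exact ((pullback.fst 𝒳.hom 𝒳.hom).isIrreducible_preimage (pullback.fst 𝒳.hom 𝒳.hom).isOpenMap h1).2
      -- a point of `F_η ∩ range ν`: take `y ∈ F_η ∩ dom ∩ ν₀(dom₀)` (two non-empty opens of the irreducible `F_η` meet)
      have hne : (Set.range p₁.base ∩ Set.range ν.left.base).Nonempty := by
        have hr : Set.range p₁.base = (𝒳 ⊗ 𝒳).hom.base ⁻¹' Set.range (specGenericPoint R K).base :=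
          Scheme.Pullback.range_fst _ _
        -- the generic point `η` of `S` and a point of `X₀` over it
        let sη : Spec (.of R) := (specGenericPoint R K).base (IsLocalRing.closedPoint K)
        have hsη : sη ∈ Set.range (specGenericPoint R K).base := ⟨_, rfl⟩
        obtain ⟨x₁, hx₁⟩ := 𝒳.hom.surjective sη
        have hx₁X₀ : x₁ ∈ X₀ := hX₀ (show 𝒳.hom.base x₁ ∈ _ by rw [hx₁]; exact hsη)
        -- (1) `F_η ∩ dom ≠ ∅`
        have hfib : ((𝒳 ⊗ 𝒳).hom.base ⁻¹' {sη}).Nonempty := by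
          obtain ⟨z, hz⟩ := (pullback.fst 𝒳.hom 𝒳.hom).surjective x₁
          refine ⟨z, ?_⟩
          change (pullback.fst 𝒳.hom 𝒳.hom ≫ 𝒳.hom).base z = sη
          rw [Scheme.Hom.comp_apply, hz, hx₁]
        obtain ⟨y₁, hy₁U, hy₁f⟩ := L.dense_dom.nonempty_inter_fibre hfib
        have h1 : (Set.range p₁.base ∩ (L.dom : Set (𝒳 ⊗ 𝒳).left)).Nonempty := by
          refine ⟨y₁, ?_, hy₁U⟩
          rw [hr]
          change (𝒳 ⊗ 𝒳).hom.base y₁ ∈ Set.range (specGenericPoint R K).base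
          rw [show (𝒳 ⊗ 𝒳).hom.base y₁ = sη from hy₁f]
          exact hsη
        -- (2) `F_η ∩ ν₀(dom₀) ≠ ∅`
        have hfib₀ : ((Over.mk (X₀.ι ≫ 𝒳.hom) ⊗ Over.mk (X₀.ι ≫ 𝒳.hom)).hom.base ⁻¹' {sη}).Nonempty := by
          have hx₀ : (Over.mk (X₀.ι ≫ 𝒳.hom)).hom.base ⟨x₁, hx₁X₀⟩ = sη := by
            change (X₀.ι ≫ 𝒳.hom).base ⟨x₁, hx₁X₀⟩ = sη
            rw [Scheme.Hom.comp_apply]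
            exact hx₁
          obtain ⟨z, hz, -⟩ := Scheme.Pullback.exists_preimage_pullback (f := (Over.mk (X₀.ι ≫ 𝒳.hom)).hom)
            (g := (Over.mk (X₀.ι ≫ 𝒳.hom)).hom) ⟨x₁, hx₁X₀⟩ ⟨x₁, hx₁X₀⟩ rfl
          refine ⟨z, ?_⟩
          rw [Set.mem_preimage, Over.tensorObj_hom]
          change (Over.mk (X₀.ι ≫ 𝒳.hom)).hom.base
            ((pullback.fst (Over.mk (X₀.ι ≫ 𝒳.hom)).hom (Over.mk (X₀.ι ≫ 𝒳.hom)).hom).base z) ∈ ({sη} : Set _)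
          rw [hz, hx₀]
          rfl
        obtain ⟨d₀, hd₀U, hd₀f⟩ := L₀.dense_dom.nonempty_inter_fibre hfib₀
        have hwι : (ι₀ ⊗ₘ ι₀).left ≫ (𝒳 ⊗ 𝒳).hom =
            ((Over.mk (X₀.ι ≫ 𝒳.hom)) ⊗ (Over.mk (X₀.ι ≫ 𝒳.hom))).hom := Over.w (ι₀ ⊗ₘ ι₀)
        have hν₀f : ∀ d : (L₀.dom : Scheme.{u}), (𝒳 ⊗ 𝒳).hom.base (ν₀.base d) =
            ((Over.mk (X₀.ι ≫ 𝒳.hom)) ⊗ (Over.mk (X₀.ι ≫ 𝒳.hom))).hom.base (L₀.dom.ι.base d) := fun d => by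
          rw [← hwι]
          rfl
        have h2 : (Set.range p₁.base ∩ Set.range ν₀.base).Nonempty := by
          refine ⟨ν₀.base ⟨d₀, hd₀U⟩, ?_, ⟨_, rfl⟩⟩
          rw [hr]
          change (𝒳 ⊗ 𝒳).hom.base (ν₀.base ⟨d₀, hd₀U⟩) ∈ Set.range (specGenericPoint R K).base
          rw [hν₀f]
          change ((Over.mk (X₀.ι ≫ 𝒳.hom)) ⊗ (Over.mk (X₀.ι ≫ 𝒳.hom))).hom.base d₀ ∈ _
          rw [show ((Over.mk (X₀.ι ≫ 𝒳.hom)) ⊗ (Over.mk (X₀.ι ≫ 𝒳.hom))).hom.base d₀ = sη from hd₀f]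
          exact hsη
        -- (3) a common point `y = ν₀ d` with `ν₀ d ∈ dom`; it lies in `D₂`, hence in the range of `ν`
        obtain ⟨y, hyF, hyU, ⟨d, rfl⟩⟩ := hFη _ _ L.dom.2 ν₀.isOpenEmbedding.isOpen_range h1 h2
        have hdD₁ : d ∈ D₁ := hyU
        have hq₁d : L.dom.ι.base (q₁.base ⟨d, hdD₁⟩) = ν₀.base d := by
          change (q₁ ≫ L.dom.ι).base ⟨d, hdD₁⟩ = (D₁.ι ≫ ν₀).base ⟨d, hdD₁⟩
          rw [hq₁]
        have hdD₂ : (⟨d, hdD₁⟩ : (D₁ : Scheme.{u})) ∈ D₂ := by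
          change (q₁ ≫ L.mul).base ⟨d, hdD₁⟩ ∈ X₀
          apply hX₀
          change (q₁ ≫ L.mul ≫ 𝒳.hom).base ⟨d, hdD₁⟩ ∈ Set.range (specGenericPoint R K).base
          rw [L.mul_comp]
          change (𝒳 ⊗ 𝒳).hom.base (L.dom.ι.base (q₁.base ⟨d, hdD₁⟩)) ∈ _
          rw [hq₁d, ← Set.mem_preimage, ← hr]
          exact hyF
        refine ⟨ν₀.base d, hyF, ⟨⟨⟨d, hdD₁⟩, hdD₂⟩, rfl⟩⟩
      -- conclude through the open embedding `p₁`
      change Dense (Set.range (F.map ν).left.base)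
      rw [hrange, hp₁.base_open.isInducing.dense_iff]
      intro w
      have himg : p₁.base '' (p₁.base ⁻¹' Set.range ν.left.base) = Set.range p₁.base ∩ Set.range ν.left.base := by
        rw [Set.image_preimage_eq_inter_range, Set.inter_comm]
      change p₁.base w ∈ closure (p₁.base '' (p₁.base ⁻¹' Set.range ν.left.base))
      rw [himg]
      exact subset_closure_inter_of_isPreirreducible_of_isOpen hFη hνo.base_open.isOpen_range hne ⟨w, rfl⟩
  obtain ⟨D', ν, q', hνo, hνq, hνm, hdense⟩ := hD
  -- P and Q agree after `F.map ν`
  have hPQν : F.map ν ≫ P = F.map ν ≫ Q := by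
    change F.map ν ≫ F.map m𝒳 ≫ e.hom = F.map ν ≫ Functor.OplaxMonoidal.δ F 𝒳 𝒳 ≫ (e.hom ⊗ₘ e.hom) ≫ μ[E]
    rw [← F.map_comp_assoc, hνm, F.map_comp_assoc, hLmul, ← F.map_comp_assoc, ← hνq]
  -- rigidity: source reduced, `E → Spec K` separated
  haveI : IsReduced (F.obj (𝒳 ⊗ 𝒳)).left := by
    -- `(𝒳 ⊗ 𝒳)_K` is an open subscheme (the generic point of a dvr is open) of the smooth, hence regular, hence
    -- reduced `𝒳 ×_R 𝒳`
    haveI : Smooth (𝒳 ⊗ 𝒳).hom := by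
      change Smooth (pullback.fst 𝒳.hom 𝒳.hom ≫ 𝒳.hom)
      infer_instance
    haveI : ∀ z : (𝒳 ⊗ 𝒳).left, _root_.IsReduced ((𝒳 ⊗ 𝒳).left.presheaf.stalk z) := fun z => by
      haveI := isRegularLocalRing_stalk_of_smooth_dvr (𝒳 := 𝒳 ⊗ 𝒳) z
      haveI := Literature.AlgebraicGeometry.Resolution.isDomain_of_isRegularLocalRing ((𝒳 ⊗ 𝒳).left.presheaf.stalk z)
      infer_instance
    have hred : IsReduced (𝒳 ⊗ 𝒳).left := isReduced_of_isReduced_stalk _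
    have hgp : IsOpenImmersion (specGenericPoint R K) := isOpenImmersion_specGenericPoint R K
    have hoi : IsOpenImmersion (pullback.fst (𝒳 ⊗ 𝒳).hom (specGenericPoint R K)) :=
      MorphismProperty.pullback_fst _ _ hgp
    exact @isReduced_of_isOpenImmersion _ _ (pullback.fst (𝒳 ⊗ 𝒳).hom (specGenericPoint R K)) hoi hred
  haveI : IsSeparated E.hom := by
    -- `E ≅ 𝒳_K`, proper over `K`
    have hE : E.hom = e.inv.left ≫ (F.obj 𝒳).hom := (Over.w e.inv).symm
    haveI : IsProper (F.obj 𝒳).hom := by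
      change IsProper (pullback.snd 𝒳.hom (specGenericPoint R K))
      infer_instance
    rw [hE]
    infer_instance
  have hPQ : P = Q := by
    apply (Over.forget _).map_injective
    exact hom_ext_of_isOpenImmersion_denseRange P.left Q.left E.hom (by rw [Over.w, Over.w]) (F.map ν).left hdense
      (by rw [← Over.comp_left, ← Over.comp_left, hPQν])
  -- §1 reduction
  refine isMonHom_map_inv_comp F u e ?_
  change Functor.LaxMonoidal.μ F 𝒳 𝒳 ≫ P = (e.hom ⊗ₘ e.hom) ≫ μ[E]
  rw [hPQ]
  change Functor.LaxMonoidal.μ F 𝒳 𝒳 ≫ Functor.OplaxMonoidal.δ F 𝒳 𝒳 ≫ (e.hom ⊗ₘ e.hom) ≫ μ[E] = _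
  rw [Functor.Monoidal.μ_δ_assoc]


end GapFOpens

end Literature.AlgebraicGeometry.GroupSchemes

end
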